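import Summits.QuantumFields.BalabanUV.Beta.D1BFx.GhostDeltaJetMasses
import Summits.QuantumFields.BalabanUV.Beta.D1BFx.RestKernelGhostUnit
import Summits.QuantumFields.BalabanUV.Beta.D1BFx.GhostLegBlockMassD1
import Literature.MathematicalPhysics.QuantumFieldTheory.Balaban1983to89.T4RateAlgebra
import Literature.MathematicalPhysics.QuantumFieldTheory.Balaban1983to89.Beta.VolumeImages

/-!
# «ΔGH-UNIT»: the `cQ`-defect of the completed ghost kernel is a (1.22) vanishing-class row, `|secondMoment ΔGH| ≤ KΔ(a)·n⁻¹`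

Road «BF-x» (BetaPertH (D1) dictionary chain), unit `b2b-balaban-beta-d1-formalise-leaf-04` (gen 18), «RK-GH-UNIT» FILE 5e = OWNER RULING ρ-g16-2
(Δ3d) «ΔGH DIRECT» (journal l.38331), estimate half. With `n = m + 1`, `ρ = ctrHalf n`, and the defect row
`ΔGH μ ν z := 2·(PghQ n a (−1) n² 0 μ ν z − PghQ n a (−1) n² a μ ν z)` = `−tadpole (Ggh n a) (W_Q μ 0 ν z) + bubble Ggh (V_Q μ 0) (V_K ν z)
+ bubble Ggh (V_K μ 0) (V_Q ν z) + bubble Ggh (V_Q μ 0) (V_Q ν z)` (`GhostDeltaWords.deltaGH_eq_words`), the four words are (5.10)-kernels at the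
n-free coarse rate `σ₀ = min (δ_PP∕8) (κ₁∕16)` with constants whose powers of `n` are DISPLAYED:
* `decay510_deltaWord_QK` ∕ `_KQ`: `(2∕min 2 a)·((cG0 + cSplit)∕n²)·(|a|·CQ)·(CK·n)` — **power `n⁻¹`** (legs `Decays Ggh` × sharp `Bdd Ggh ≤ (cG0 + cSplit)∕n²`,
  jets `V_Q = O(|a|)·n⁰` (FILE 5d) and `V_K = O(n)` (FILE 3b));
* `decay510_deltaWord_QQ`: `(2∕min 2 a)·((cG0 + cSplit)∕n²)·(|a|·CQ)²` — **power `n⁻²`**;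
* `decay510_deltaWord_tadpole`: `((cG0 + cSplit)∕n²)·(|−1|·|a|·CW·n⁻¹)` — **power `n⁻³`** (rate `κ₁∕8`, weakened to `σ₀`);
and therefore (**`abs_secondMoment_deltaGH_le`**) `|secondMoment ΔGH μ ν| ≤ KΔ(a)·n⁻¹` with the n-free
`KΔ(a) := ((cG0 + cSplit)·(|a|·CW) + 2·((2∕min 2 a)·(cG0 + cSplit)·(|a|·CQ)·CK) + (2∕min 2 a)·(cG0 + cSplit)·(|a|·CQ)²)·M(σ₀)` spelled out in the
statement (`CQ, CK, CW` the constants of FILES 5d∕3b∕5d, `M(σ₀) = Σ'_x |x|₁²e^{−σ₀|x|₁}`), plus the unit form `… ≤ KΔ(a)` (`abs_secondMoment_deltaGH_le_unit`).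
UNCONDITIONAL (`0 < a`); [folklore] estimates about OUR packed objects; 0 sorry ∕ def ∕ `def … : Prop` ∕ cite. What it is for: leaf-01 wires `uΔGH` into
`Rk` (W-d1leaf01-g20-3); with FILE 4b's RK-GH row the ghost part of the (K) rest kernel is (1.22)-vanishing. HONEST: 0 root-level binders discharged;
(K) NOT closed; NOT D1, NOT BetaPertH, NOT continuum, NOT Clay.
-/

open Finset
open scoped BigOperators
open Literature.MathematicalPhysics.QuantumFieldTheory.Balaban1983to89
open Literature.MathematicalPhysics.QuantumFieldTheory.Balaban1983to89.Beta
open Literature.MathematicalPhysics.QuantumFieldTheory.Balaban1983to89.T4RateAlgebra (decay510_add decay510_neg)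
open B12Sec2to5 (l1 l1_nonneg Decay510)
open B5Hk163Strip (kappa163 kappa163_pos)
open B5Hk163Decay (MG163)
open B4TorusKernel (periodConst)
open ExpKernelCalculus (Site MKer Decays tadpole bubble)
open KernelWard (Bdd)
open Summit.QuantumFields.BalabanUV.Beta.D1BFx.PackedKernelSplit (biBubble bubble_eq_biBubble)
open Summit.QuantumFields.BalabanUV.Beta.D1BFx.RProjector (deltaPP deltaPP_pos)
open Summit.QuantumFields.BalabanUV.Beta.D1BFx.GhostLeg (Ggh const_nonneg)
open Summit.QuantumFields.BalabanUV.Beta.D1BFx.PointColumnSplit (cG0 cG0_nonneg cSplit cSplit_nonneg)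
open Summit.QuantumFields.BalabanUV.Beta.D1BFx.GhostLegBlockMassD1 (abs_Ggh_le_sharp)
open Summit.QuantumFields.BalabanUV.Beta.D1BFx.GhostStencilRooted (SghAt)
open Summit.QuantumFields.BalabanUV.Beta.D1BFx.GhostStencilRootedReflection (ctrHalf ctrHalf_mem)
open Summit.QuantumFields.BalabanUV.Beta.D1BFx.GhostAveragingSquare (WghAt)
open Summit.QuantumFields.BalabanUV.Beta.D1BFx.GhostKernelComplete (PghQ)
open Summit.QuantumFields.BalabanUV.Beta.D1BFx.ReducedKernelF (vertexRedF)
open Summit.QuantumFields.BalabanUV.Beta.D1BFx.ReducedTableF (tableRedF)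
open Summit.QuantumFields.BalabanUV.Beta.D1BFx.GhostWordFamilies (decay510_tadpoleWord_of_mass decay510_biBubbleWord_of_decays_bdd_mass)
open Summit.QuantumFields.BalabanUV.Beta.D1BFx.RestKernelGhostUnit (sigma_facts decays_Ggh_sigma abs_secondMoment_le momentSum_nonneg)
open Summit.QuantumFields.BalabanUV.Beta.D1BFx.GhostDeltaJetMasses (mass_vertexRedF_SghAt_Q_le mass_vertexRedF_SghAt_K_le mass_tableRedF_WghAt_Q_le)
open Summit.QuantumFields.BalabanUV.Beta.D1BFx.GhostDeltaWords (deltaGH_eq_words)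

namespace Summit.QuantumFields.BalabanUV.Beta.D1BFx.RestKernelGhostDelta
variable (m : ℕ) {a : ℝ}

/-! ## §1 The legs and the jets at the common rate -/

/-- [folklore] The ghost leg's SHARP sup as a `Bdd` letter: `Bdd (Ggh n a) ((cG0 + cSplit)∕n²)` (`GhostLegBlockMassD1.abs_Ggh_le_sharp`). -/
theorem bdd_Ggh_sharp (ha : 0 < a) : Bdd (Ggh (m + 1) a) ((cG0 4 + cSplit 4 a) / (((m + 1 : ℕ) : ℝ)) ^ 2) :=
  fun x y _ _ => abs_Ggh_le_sharp (m + 1) ha x y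

/-- [folklore] The sharp sup constant is nonnegative. -/
theorem sharp_nonneg (ha : 0 < a) : 0 ≤ (cG0 4 + cSplit 4 a) / (((m + 1 : ℕ) : ℝ)) ^ 2 := by
  have := cG0_nonneg 4; have := cSplit_nonneg 4 ha; positivity

section Words
variable (ha : 0 < a)
include ha

/-- [folklore] **THE QK BUBBLE** `z ↦ bubble Ggh (V_Q μ 0) (V_K ν z)`: `Decay510 · ((2∕min 2 a)·((cG0 + cSplit)∕n²)·(|a|·CQ)·(CK·n)) σ₀` — **power `n⁻¹`**. -/
theorem decay510_deltaWord_QK (μ ν : Fin 4) :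
    Decay510 (fun z => bubble (Ggh (m + 1) a) (vertexRedF (m + 1) (SghAt (ctrHalf (m + 1)) (m + 1) 0 a) μ 0)
        (vertexRedF (m + 1) (SghAt (ctrHalf (m + 1)) (m + 1) ((((m + 1 : ℕ) : ℝ)) ^ 2) 0) ν z))
      ((2 / min 2 a) * ((cG0 4 + cSplit 4 a) / (((m + 1 : ℕ) : ℝ)) ^ 2)
        * (|a| * (8 * Real.exp (kappa163 (3 + 1) / (3 + 1)) *
            ((MG163 (3 + 1) * periodConst (kappa163 (3 + 1)) 3) * Real.exp (kappa163 (3 + 1) / (3 + 1))) * (1 + 16 / (kappa163 (3 + 1) / (3 + 1))) ^ 4))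
        * (8 * Real.exp (kappa163 (3 + 1) / (3 + 1) / 16) * (MG163 (3 + 1) * periodConst (kappa163 (3 + 1)) 3) * Real.exp (kappa163 (3 + 1) / (3 + 1))
          * (1 + 16 / (kappa163 (3 + 1) / (3 + 1))) ^ 4 * ((m + 1 : ℕ) : ℝ)))
      (min (deltaPP 4 a / 8) (kappa163 (3 + 1) / (3 + 1) / 16)) := by
  obtain ⟨hσ0, hσκ, -, -, hσN, -⟩ := sigma_facts m ha
  have hQ := fun y => mass_vertexRedF_SghAt_Q_le m (ctrHalf_mem (m + 1)) hσ0 hσκ a μ y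
  have hK := fun y => mass_vertexRedF_SghAt_K_le m (ctrHalf (m + 1)) hσ0 hσκ ν y
  have h := decay510_biBubbleWord_of_decays_bdd_mass (N := m + 1) (𝒱 := vertexRedF (m + 1) (SghAt (ctrHalf (m + 1)) (m + 1) 0 a))
    (𝒱' := vertexRedF (m + 1) (SghAt (ctrHalf (m + 1)) (m + 1) ((((m + 1 : ℕ) : ℝ)) ^ 2) 0))
    (decays_Ggh_sigma m ha) (bdd_Ggh_sharp m ha) hσ0 (le_of_lt (by have := lt_min (by norm_num : (0:ℝ) < 2) ha; positivity)) (sharp_nonneg m ha) μ ν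
    (fun y => (hQ y).1) (fun y => (hQ y).2) (fun y => (hK y).1) (fun y => (hK y).2)
  rw [hσN] at h
  simpa only [bubble_eq_biBubble] using h

/-- [folklore] **THE KQ BUBBLE** `z ↦ bubble Ggh (V_K μ 0) (V_Q ν z)`: the same constant with the jets' factors swapped — **power `n⁻¹`**. -/
theorem decay510_deltaWord_KQ (μ ν : Fin 4) :
    Decay510 (fun z => bubble (Ggh (m + 1) a) (vertexRedF (m + 1) (SghAt (ctrHalf (m + 1)) (m + 1) ((((m + 1 : ℕ) : ℝ)) ^ 2) 0) μ 0)
        (vertexRedF (m + 1) (SghAt (ctrHalf (m + 1)) (m + 1) 0 a) ν z))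
      ((2 / min 2 a) * ((cG0 4 + cSplit 4 a) / (((m + 1 : ℕ) : ℝ)) ^ 2)
        * (8 * Real.exp (kappa163 (3 + 1) / (3 + 1) / 16) * (MG163 (3 + 1) * periodConst (kappa163 (3 + 1)) 3) * Real.exp (kappa163 (3 + 1) / (3 + 1))
          * (1 + 16 / (kappa163 (3 + 1) / (3 + 1))) ^ 4 * ((m + 1 : ℕ) : ℝ))
        * (|a| * (8 * Real.exp (kappa163 (3 + 1) / (3 + 1)) *
            ((MG163 (3 + 1) * periodConst (kappa163 (3 + 1)) 3) * Real.exp (kappa163 (3 + 1) / (3 + 1))) * (1 + 16 / (kappa163 (3 + 1) / (3 + 1))) ^ 4)))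
      (min (deltaPP 4 a / 8) (kappa163 (3 + 1) / (3 + 1) / 16)) := by
  obtain ⟨hσ0, hσκ, -, -, hσN, -⟩ := sigma_facts m ha
  have hQ := fun y => mass_vertexRedF_SghAt_Q_le m (ctrHalf_mem (m + 1)) hσ0 hσκ a ν y
  have hK := fun y => mass_vertexRedF_SghAt_K_le m (ctrHalf (m + 1)) hσ0 hσκ μ y
  have h := decay510_biBubbleWord_of_decays_bdd_mass (N := m + 1) (𝒱 := vertexRedF (m + 1) (SghAt (ctrHalf (m + 1)) (m + 1) ((((m + 1 : ℕ) : ℝ)) ^ 2) 0))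
    (𝒱' := vertexRedF (m + 1) (SghAt (ctrHalf (m + 1)) (m + 1) 0 a))
    (decays_Ggh_sigma m ha) (bdd_Ggh_sharp m ha) hσ0 (le_of_lt (by have := lt_min (by norm_num : (0:ℝ) < 2) ha; positivity)) (sharp_nonneg m ha) μ ν
    (fun y => (hK y).1) (fun y => (hK y).2) (fun y => (hQ y).1) (fun y => (hQ y).2)
  rw [hσN] at h
  simpa only [bubble_eq_biBubble] using h

/-- [folklore] **THE QQ BUBBLE** `z ↦ bubble Ggh (V_Q μ 0) (V_Q ν z)`: `Decay510 · ((2∕min 2 a)·((cG0 + cSplit)∕n²)·(|a|·CQ)·(|a|·CQ)) σ₀` — **power `n⁻²`**. -/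
theorem decay510_deltaWord_QQ (μ ν : Fin 4) :
    Decay510 (fun z => bubble (Ggh (m + 1) a) (vertexRedF (m + 1) (SghAt (ctrHalf (m + 1)) (m + 1) 0 a) μ 0)
        (vertexRedF (m + 1) (SghAt (ctrHalf (m + 1)) (m + 1) 0 a) ν z))
      ((2 / min 2 a) * ((cG0 4 + cSplit 4 a) / (((m + 1 : ℕ) : ℝ)) ^ 2)
        * (|a| * (8 * Real.exp (kappa163 (3 + 1) / (3 + 1)) *
            ((MG163 (3 + 1) * periodConst (kappa163 (3 + 1)) 3) * Real.exp (kappa163 (3 + 1) / (3 + 1))) * (1 + 16 / (kappa163 (3 + 1) / (3 + 1))) ^ 4))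
        * (|a| * (8 * Real.exp (kappa163 (3 + 1) / (3 + 1)) *
            ((MG163 (3 + 1) * periodConst (kappa163 (3 + 1)) 3) * Real.exp (kappa163 (3 + 1) / (3 + 1))) * (1 + 16 / (kappa163 (3 + 1) / (3 + 1))) ^ 4)))
      (min (deltaPP 4 a / 8) (kappa163 (3 + 1) / (3 + 1) / 16)) := by
  obtain ⟨hσ0, hσκ, -, -, hσN, -⟩ := sigma_facts m ha
  have hQ := fun y => mass_vertexRedF_SghAt_Q_le m (ctrHalf_mem (m + 1)) hσ0 hσκ a μ y
  have hQ' := fun y => mass_vertexRedF_SghAt_Q_le m (ctrHalf_mem (m + 1)) hσ0 hσκ a ν y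
  have h := decay510_biBubbleWord_of_decays_bdd_mass (N := m + 1) (𝒱 := vertexRedF (m + 1) (SghAt (ctrHalf (m + 1)) (m + 1) 0 a))
    (𝒱' := vertexRedF (m + 1) (SghAt (ctrHalf (m + 1)) (m + 1) 0 a))
    (decays_Ggh_sigma m ha) (bdd_Ggh_sharp m ha) hσ0 (le_of_lt (by have := lt_min (by norm_num : (0:ℝ) < 2) ha; positivity)) (sharp_nonneg m ha) μ ν
    (fun y => (hQ y).1) (fun y => (hQ y).2) (fun y => (hQ' y).1) (fun y => (hQ' y).2)
  rw [hσN] at h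
  simpa only [bubble_eq_biBubble] using h

/-- [folklore] **THE `qSq` TADPOLE** `z ↦ tadpole Ggh (W_Q μ 0 ν z)`: `Decay510 · (((cG0 + cSplit)∕n²)·(|−1|·|a|·CW·n⁻¹)) σ₀` — **power `n⁻³`** (FILE 5d's table mass,
rate `κ₁∕8 ≥ σ₀`). -/
theorem decay510_deltaWord_tadpole (μ ν : Fin 4) :
    Decay510 (fun z => tadpole (Ggh (m + 1) a) (tableRedF (m + 1) (WghAt (ctrHalf (m + 1)) (m + 1) (-1) 0 a) μ 0 ν z))
      (((cG0 4 + cSplit 4 a) / (((m + 1 : ℕ) : ℝ)) ^ 2)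
        * (|(-1 : ℝ)| * |a| * (64 * Real.exp (kappa163 (3 + 1) / (3 + 1)) *
            ((MG163 (3 + 1) * periodConst (kappa163 (3 + 1)) 3) * Real.exp (kappa163 (3 + 1) / (3 + 1))) ^ 2 * (1 + 16 / (kappa163 (3 + 1) / (3 + 1))) ^ 4) *
          (((m + 1 : ℕ) : ℝ))⁻¹))
      (min (deltaPP 4 a / 8) (kappa163 (3 + 1) / (3 + 1) / 16)) := by
  have hW := fun z => mass_tableRedF_WghAt_Q_le m (ctrHalf_mem (m + 1)) (-1) a μ ν z
  have h := decay510_tadpoleWord_of_mass (𝒲 := tableRedF (m + 1) (WghAt (ctrHalf (m + 1)) (m + 1) (-1) 0 a)) (bdd_Ggh_sharp m ha) (sharp_nonneg m ha) μ ν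
    (fun z => (hW z).1) (fun z => (hW z).2)
  refine decay510_mono h ((min_le_right _ _).trans ?_)
  have := kappa163_pos (3 + 1)
  have e : kappa163 (3 + 1) / (3 + 1) / 16 = kappa163 (3 + 1) / (3 + 1) / 8 / 2 := by ring
  rw [e]; exact half_le_self (by positivity)

/-! ## §2 The row -/

/-- [folklore] **«ΔGH-UNIT» — THE DEFECT ROW IS (1.22)-VANISHING, `|secondMoment ΔGH μ ν| ≤ KΔ(a)·n⁻¹`** with the n-free `KΔ(a)` displayed in the statement
(`ΔGH μ ν z := 2·(PghQ n a (−1) n² 0 μ ν z − PghQ n a (−1) n² a μ ν z)`, `n = m + 1`). -/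
theorem abs_secondMoment_deltaGH_le (μ ν : Fin 4) :
    |B12Beta.secondMoment (fun μ ν z => 2 * (PghQ (m + 1) a (-1) ((((m + 1 : ℕ) : ℝ)) ^ 2) 0 μ ν z
        - PghQ (m + 1) a (-1) ((((m + 1 : ℕ) : ℝ)) ^ 2) a μ ν z)) μ ν|
      ≤ (((cG0 4 + cSplit 4 a) * (|a| * (64 * Real.exp (kappa163 (3 + 1) / (3 + 1)) *
              ((MG163 (3 + 1) * periodConst (kappa163 (3 + 1)) 3) * Real.exp (kappa163 (3 + 1) / (3 + 1))) ^ 2 * (1 + 16 / (kappa163 (3 + 1) / (3 + 1))) ^ 4))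
          + 2 * ((2 / min 2 a) * (cG0 4 + cSplit 4 a)
              * (|a| * (8 * Real.exp (kappa163 (3 + 1) / (3 + 1)) *
                  ((MG163 (3 + 1) * periodConst (kappa163 (3 + 1)) 3) * Real.exp (kappa163 (3 + 1) / (3 + 1))) * (1 + 16 / (kappa163 (3 + 1) / (3 + 1))) ^ 4))
              * (8 * Real.exp (kappa163 (3 + 1) / (3 + 1) / 16) * (MG163 (3 + 1) * periodConst (kappa163 (3 + 1)) 3) * Real.exp (kappa163 (3 + 1) / (3 + 1))
                  * (1 + 16 / (kappa163 (3 + 1) / (3 + 1))) ^ 4))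
          + (2 / min 2 a) * (cG0 4 + cSplit 4 a)
              * (|a| * (8 * Real.exp (kappa163 (3 + 1) / (3 + 1)) *
                  ((MG163 (3 + 1) * periodConst (kappa163 (3 + 1)) 3) * Real.exp (kappa163 (3 + 1) / (3 + 1))) * (1 + 16 / (kappa163 (3 + 1) / (3 + 1))) ^ 4)) ^ 2)
          * ∑' x : Site 4, l1 x ^ 2 * Real.exp (-(min (deltaPP 4 a / 8) (kappa163 (3 + 1) / (3 + 1) / 16)) * l1 x))
        * (((m + 1 : ℕ) : ℝ))⁻¹ := by
  obtain ⟨-, -, -, -, -, hσpos⟩ := sigma_facts m ha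
  have hn : (0 : ℝ) < ((m + 1 : ℕ) : ℝ) := by exact_mod_cast Nat.succ_pos m
  have hn1 : (1 : ℝ) ≤ ((m + 1 : ℕ) : ℝ) := by exact_mod_cast Nat.le_add_left 1 m
  -- the four words
  have hT := decay510_deltaWord_tadpole m ha μ ν
  have h1 := decay510_deltaWord_QK m ha μ ν
  have h2 := decay510_deltaWord_KQ m ha μ ν
  have h3 := decay510_deltaWord_QQ m ha μ ν
  simp only [abs_neg, abs_one, one_mul] at hT
  -- the letters
  set SB : ℝ := cG0 4 + cSplit 4 a with hSB
  set SG : ℝ := 2 / min 2 a with hSG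
  set CQ : ℝ := |a| * (8 * Real.exp (kappa163 (3 + 1) / (3 + 1)) *
      ((MG163 (3 + 1) * periodConst (kappa163 (3 + 1)) 3) * Real.exp (kappa163 (3 + 1) / (3 + 1))) * (1 + 16 / (kappa163 (3 + 1) / (3 + 1))) ^ 4) with hCQ
  set CK : ℝ := 8 * Real.exp (kappa163 (3 + 1) / (3 + 1) / 16) * (MG163 (3 + 1) * periodConst (kappa163 (3 + 1)) 3) * Real.exp (kappa163 (3 + 1) / (3 + 1))
      * (1 + 16 / (kappa163 (3 + 1) / (3 + 1))) ^ 4 with hCK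
  set CW : ℝ := |a| * (64 * Real.exp (kappa163 (3 + 1) / (3 + 1)) *
      ((MG163 (3 + 1) * periodConst (kappa163 (3 + 1)) 3) * Real.exp (kappa163 (3 + 1) / (3 + 1))) ^ 2 * (1 + 16 / (kappa163 (3 + 1) / (3 + 1))) ^ 4) with hCW
  set MS : ℝ := ∑' x : Site 4, l1 x ^ 2 * Real.exp (-(min (deltaPP 4 a / 8) (kappa163 (3 + 1) / (3 + 1) / 16)) * l1 x) with hMS
  have hSB0 : 0 ≤ SB := by have := cG0_nonneg 4; have := cSplit_nonneg 4 ha; positivity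
  have hSG0 : 0 ≤ SG := by have := lt_min (by norm_num : (0:ℝ) < 2) ha; positivity
  have hCQ0 : 0 ≤ CQ := by
    have h := (mass_vertexRedF_SghAt_Q_le m (ctrHalf_mem (m + 1)) le_rfl (by have := kappa163_pos (3 + 1); positivity) a μ 0).2
    exact (tsum_nonneg fun p => Finset.sum_nonneg fun g _ => Finset.sum_nonneg fun f _ => by positivity).trans h
  have hCK0 : 0 ≤ CK * ((m + 1 : ℕ) : ℝ) := by
    have h := (mass_vertexRedF_SghAt_K_le m (ctrHalf (m + 1)) le_rfl (by have := kappa163_pos (3 + 1); positivity) μ 0).2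
    exact (tsum_nonneg fun p => Finset.sum_nonneg fun g _ => Finset.sum_nonneg fun f _ => by positivity).trans h
  have hCK0' : 0 ≤ CK := (mul_nonneg_iff_of_pos_right hn).1 hCK0
  have hCW0 : 0 ≤ CW * (((m + 1 : ℕ) : ℝ))⁻¹ := by
    have h := (mass_tableRedF_WghAt_Q_le m (ctrHalf_mem (m + 1)) (-1) a μ ν 0).2
    have h0 := (tsum_nonneg fun p => Finset.sum_nonneg fun g _ => Finset.sum_nonneg fun f _ => abs_nonneg
      (tableRedF (m + 1) (WghAt (ctrHalf (m + 1)) (m + 1) (-1) 0 a) μ 0 ν 0 p.1 p.2 g f)).trans h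
    simp only [abs_neg, abs_one, one_mul] at h0
    rw [show l1 (0 : Site 4) = 0 from by simp [l1], mul_zero, Real.exp_zero, mul_one] at h0
    rw [hCW]; exact h0
  have hCW0' : 0 ≤ CW := (mul_nonneg_iff_of_pos_right (inv_pos.2 hn)).1 hCW0
  have hMS0 : 0 ≤ MS := momentSum_nonneg _
  -- the four words, one (5.10)-kernel
  have h123 := decay510_add (decay510_add h1 h2 (fun _ => rfl)) h3 (h := fun z =>
      bubble (Ggh (m + 1) a) (vertexRedF (m + 1) (SghAt (ctrHalf (m + 1)) (m + 1) 0 a) μ 0)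
          (vertexRedF (m + 1) (SghAt (ctrHalf (m + 1)) (m + 1) ((((m + 1 : ℕ) : ℝ)) ^ 2) 0) ν z)
        + bubble (Ggh (m + 1) a) (vertexRedF (m + 1) (SghAt (ctrHalf (m + 1)) (m + 1) ((((m + 1 : ℕ) : ℝ)) ^ 2) 0) μ 0)
          (vertexRedF (m + 1) (SghAt (ctrHalf (m + 1)) (m + 1) 0 a) ν z)
        + bubble (Ggh (m + 1) a) (vertexRedF (m + 1) (SghAt (ctrHalf (m + 1)) (m + 1) 0 a) μ 0)
          (vertexRedF (m + 1) (SghAt (ctrHalf (m + 1)) (m + 1) 0 a) ν z)) (fun _ => rfl)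
  have hΔ : Decay510 ((fun μ ν z => 2 * (PghQ (m + 1) a (-1) ((((m + 1 : ℕ) : ℝ)) ^ 2) 0 μ ν z
        - PghQ (m + 1) a (-1) ((((m + 1 : ℕ) : ℝ)) ^ 2) a μ ν z)) μ ν)
      (SB / (((m + 1 : ℕ) : ℝ)) ^ 2 * (CW * (((m + 1 : ℕ) : ℝ))⁻¹)
        + (SG * (SB / (((m + 1 : ℕ) : ℝ)) ^ 2) * CQ * (CK * ((m + 1 : ℕ) : ℝ)) + SG * (SB / (((m + 1 : ℕ) : ℝ)) ^ 2) * (CK * ((m + 1 : ℕ) : ℝ)) * CQ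
          + SG * (SB / (((m + 1 : ℕ) : ℝ)) ^ 2) * CQ * CQ))
      (min (deltaPP 4 a / 8) (kappa163 (3 + 1) / (3 + 1) / 16)) :=
    decay510_add (decay510_neg hT) h123 fun z => by
      show 2 * (PghQ (m + 1) a (-1) ((((m + 1 : ℕ) : ℝ)) ^ 2) 0 μ ν z - PghQ (m + 1) a (-1) ((((m + 1 : ℕ) : ℝ)) ^ 2) a μ ν z) = _
      rw [deltaGH_eq_words (m + 1) ha μ ν z]
  refine (abs_secondMoment_le hσpos hΔ).trans ?_
  rw [← hMS]
  -- arithmetic: every word's constant is `≤ (its n-free atom)·n⁻¹`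
  have hinv2 : ((((m + 1 : ℕ) : ℝ)) ^ 2)⁻¹ ≤ (((m + 1 : ℕ) : ℝ))⁻¹ := by
    rw [inv_le_inv₀ (by positivity) hn]; nlinarith
  have a0 : SB / (((m + 1 : ℕ) : ℝ)) ^ 2 * (CW * (((m + 1 : ℕ) : ℝ))⁻¹) ≤ SB * CW * (((m + 1 : ℕ) : ℝ))⁻¹ := by
    rw [div_eq_mul_inv]
    calc SB * ((((m + 1 : ℕ) : ℝ)) ^ 2)⁻¹ * (CW * (((m + 1 : ℕ) : ℝ))⁻¹) = (SB * CW * (((m + 1 : ℕ) : ℝ))⁻¹) * ((((m + 1 : ℕ) : ℝ)) ^ 2)⁻¹ := by ring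
      _ ≤ (SB * CW * (((m + 1 : ℕ) : ℝ))⁻¹) * 1 :=
          mul_le_mul_of_nonneg_left (inv_le_one_of_one_le₀ (by nlinarith)) (by positivity)
      _ = _ := mul_one _
  have a1 : SG * (SB / (((m + 1 : ℕ) : ℝ)) ^ 2) * CQ * (CK * ((m + 1 : ℕ) : ℝ)) = SG * SB * CQ * CK * (((m + 1 : ℕ) : ℝ))⁻¹ := by
    field_simp
  have a2 : SG * (SB / (((m + 1 : ℕ) : ℝ)) ^ 2) * (CK * ((m + 1 : ℕ) : ℝ)) * CQ = SG * SB * CQ * CK * (((m + 1 : ℕ) : ℝ))⁻¹ := by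
    field_simp
  have a3 : SG * (SB / (((m + 1 : ℕ) : ℝ)) ^ 2) * CQ * CQ ≤ SG * SB * CQ ^ 2 * (((m + 1 : ℕ) : ℝ))⁻¹ := by
    rw [div_eq_mul_inv]
    calc SG * (SB * ((((m + 1 : ℕ) : ℝ)) ^ 2)⁻¹) * CQ * CQ = (SG * SB * CQ ^ 2) * ((((m + 1 : ℕ) : ℝ)) ^ 2)⁻¹ := by ring
      _ ≤ (SG * SB * CQ ^ 2) * (((m + 1 : ℕ) : ℝ))⁻¹ := mul_le_mul_of_nonneg_left hinv2 (by positivity)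
  rw [a1, a2]
  have hsum : SB / (((m + 1 : ℕ) : ℝ)) ^ 2 * (CW * (((m + 1 : ℕ) : ℝ))⁻¹)
      + (SG * SB * CQ * CK * (((m + 1 : ℕ) : ℝ))⁻¹ + SG * SB * CQ * CK * (((m + 1 : ℕ) : ℝ))⁻¹ + SG * (SB / (((m + 1 : ℕ) : ℝ)) ^ 2) * CQ * CQ)
      ≤ (SB * CW + 2 * (SG * SB * CQ * CK) + SG * SB * CQ ^ 2) * (((m + 1 : ℕ) : ℝ))⁻¹ := by linarith [a0, a3]
  calc _ ≤ (SB * CW + 2 * (SG * SB * CQ * CK) + SG * SB * CQ ^ 2) * (((m + 1 : ℕ) : ℝ))⁻¹ * MS := mul_le_mul_of_nonneg_right hsum hMS0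
    _ = _ := by ring

/-- [folklore] **THE (1.22) UNIT-ROW FORM**: `|secondMoment ΔGH μ ν| ≤ KΔ(a)` (`n⁻¹ ≤ 1`). -/
theorem abs_secondMoment_deltaGH_le_unit (μ ν : Fin 4) :
    |B12Beta.secondMoment (fun μ ν z => 2 * (PghQ (m + 1) a (-1) ((((m + 1 : ℕ) : ℝ)) ^ 2) 0 μ ν z
        - PghQ (m + 1) a (-1) ((((m + 1 : ℕ) : ℝ)) ^ 2) a μ ν z)) μ ν|
      ≤ ((cG0 4 + cSplit 4 a) * (|a| * (64 * Real.exp (kappa163 (3 + 1) / (3 + 1)) *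
              ((MG163 (3 + 1) * periodConst (kappa163 (3 + 1)) 3) * Real.exp (kappa163 (3 + 1) / (3 + 1))) ^ 2 * (1 + 16 / (kappa163 (3 + 1) / (3 + 1))) ^ 4))
          + 2 * ((2 / min 2 a) * (cG0 4 + cSplit 4 a)
              * (|a| * (8 * Real.exp (kappa163 (3 + 1) / (3 + 1)) *
                  ((MG163 (3 + 1) * periodConst (kappa163 (3 + 1)) 3) * Real.exp (kappa163 (3 + 1) / (3 + 1))) * (1 + 16 / (kappa163 (3 + 1) / (3 + 1))) ^ 4))
              * (8 * Real.exp (kappa163 (3 + 1) / (3 + 1) / 16) * (MG163 (3 + 1) * periodConst (kappa163 (3 + 1)) 3) * Real.exp (kappa163 (3 + 1) / (3 + 1))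
                  * (1 + 16 / (kappa163 (3 + 1) / (3 + 1))) ^ 4))
          + (2 / min 2 a) * (cG0 4 + cSplit 4 a)
              * (|a| * (8 * Real.exp (kappa163 (3 + 1) / (3 + 1)) *
                  ((MG163 (3 + 1) * periodConst (kappa163 (3 + 1)) 3) * Real.exp (kappa163 (3 + 1) / (3 + 1))) * (1 + 16 / (kappa163 (3 + 1) / (3 + 1))) ^ 4)) ^ 2)
          * ∑' x : Site 4, l1 x ^ 2 * Real.exp (-(min (deltaPP 4 a / 8) (kappa163 (3 + 1) / (3 + 1) / 16)) * l1 x) := by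
  have h := abs_secondMoment_deltaGH_le m ha μ ν
  have hn1 : (1 : ℝ) ≤ ((m + 1 : ℕ) : ℝ) := by exact_mod_cast Nat.le_add_left 1 m
  have hK := (abs_nonneg _).trans (abs_secondMoment_deltaGH_le m ha μ ν)
  have hinv : (((m + 1 : ℕ) : ℝ))⁻¹ ≤ 1 := inv_le_one_of_one_le₀ hn1
  have hpos : (0 : ℝ) < (((m + 1 : ℕ) : ℝ))⁻¹ := by positivity
  refine h.trans ?_
  have hK' := (mul_nonneg_iff_of_pos_right hpos).1 hK
  calc _ ≤ _ * (1 : ℝ) := mul_le_mul_of_nonneg_left hinv hK'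
    _ = _ := mul_one _

end Words

end Summit.QuantumFields.BalabanUV.Beta.D1BFx.RestKernelGhostDelta
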